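import Summits.RiemannHypothesis.RiemannHypothesis.Theorems.GroundBartaEvenWinsBeyondArchDeflationCertBridge
import Summits.RiemannHypothesis.RiemannHypothesis.Theorems.GroundBartaEvenWinsBeyondArchDeflationSigma
import Summits.RiemannHypothesis.RiemannHypothesis.Theorems.GroundBartaEvenWinsBeyondArchDeflationConsequences
import Literature.NumberTheory.LFunctions.WeilFinitePrimeSliver
import HarnessLib

/-!
# RiemannHypothesis / MOTIVIC-DOOR ladder — the certificate bridge on EVERY window below `log 4`, both sectors

Helper file of the pub-rhdoor LADDER (`Theorems/MotivicDoorRungs.lean`, rungs `R4(c) : WeilPositivityOn c`), RH-free,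
Mathlib + landed tree files only, no definitions, no named facts.  Honest framing of the cell: lottery ticket at the
motivic door; RH probability negligible; the consolation prizes are real.

GroundBarta's bridge `dt_weilOddGroundEnergy_ge_of_deflCert` (prover A, `…DeflationCertBridge`) turns the conclusion of a
rank-one augmented TWO-PRIME certificate (level `β₂₃`, penalty data `R`, half-width `a₀`) into the complement hypothesis of
prover B's deflated Temple / Lehmann–Maehly bound `dt_weilOddGroundEnergy_ge_of_ritz` — for the ODD sector and a window
`c ≤ (log 5)/2`, where the sliver costs `(log 2)/2`.  With the general sliver loss
`ℓ(3, N) = Σ_{3 < n ≤ N} Λ(n)/√n` (`Literature/…/WeilFinitePrimeSliver.lean`: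
`E₂₃(g) − ℓ(3,N)‖g‖₂² ≤ Re Q(g)` for `tsupport g ⊆ [-c, c]`, `c < log 4`, `c ≤ (log (N+1))/2`) the same bridge serves EVERY
window `c < log 4` — in particular the ladder's rungs `R4e–R4h` up to `c = log 3 = (log 9)/2` (`N = 8`,
`ℓ(3,8) = (log 2)/2 + (log 5)/√5 + (log 7)/√7 + (log 2)/√8 ≈ 2.047`) — and BOTH sectors (the positivity rung needs
`0 ≤ ε_ev(c)` and `0 ≤ ε_od(c)`, `dt_weilPositivityOn` / `MotivicDoor.Rungs.rung_of_sector_blocks`):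

* `hcert_of_cert23_sliverLoss` — certificate conclusion on `[-a₀, a₀]` (any parity class `P`) + sliver loss ⇒ the TRUE-form
  complement hypothesis at level `β₂₃ − ℓ(3, N)` on `[-c, c]`, `c ≤ a₀`;
* `dt_weilOddGroundEnergy_ge_of_deflCert_sliverLoss`, `dt_weilEvenGroundEnergy_ge_of_deflCert_sliverLoss` — `λ ≤ ε_od(c)`,
  `λ ≤ ε_ev(c)` from an odd / even two-prime certificate, the PSD datum of B's theorem, and `λ < β₂₃ − ℓ(3, N)`;
* `…_sigma` — the same with the PSD datum replaced by the sigma criterion (`dt_psd_of_sigma`, file XIII);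
* `rung_of_sector_lower_bounds` — two non-negative sector lower bounds at `c` give the rung `WeilPositivityOn a`, `a ≤ c`;
* `window_log_three` — `log 3 = (log (8+1))/2 < log 4`: the last rung this bridge reaches is `R4h = WeilPositivityOn (log 3)`.

What it does NOT do: produce any certificate (one writer: GroundBarta's generator) — the FORMAT WALL of the ladder
(LADDER.md §3) is now the single inequality `β₂₃ > ℓ(3, N)` on the two-prime certificate's level.

References: N. J. Lehmann, Numer. Math. 5 (1963) [Lehmann1963]; F. Goerisch, H. Haunhorst, ZAMM 65 (1985) [GoerischHaunhorst1985];
A. Weinstein, W. Stenger (1972) Ch. 5 §9 [WeinsteinStenger1972]; H. Yoshida, Adv. Stud. Pure Math. 21 (1992) §2 [Yoshida1992].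
Unit `pub-rhdoor-lad-1` (gen 2); consumer of provers A/B (`sr-gb-rung-a/b`) files IX, XIII and the bridge.
-/

set_option linter.dupNamespace false

noncomputable section

open MeasureTheory Set Filter
open scoped Topology ComplexConjugate BigOperators

namespace Summit.RiemannHypothesis.RiemannHypothesis.Theorems.MotivicDoor.SliverBridge

open Literature.NumberTheory.LFunctions
open Summit.RiemannHypothesis.RiemannHypothesis.Theorems.EvenWinsBeyondArch
open Summit.RiemannHypothesis.RiemannHypothesis.Theorems.OddSector (weilDirichletEnergy₂ weilPoleForm₂)

/-- **Certificate conclusion + sliver loss ⇒ true-form complement hypothesis.**  If a rank-one augmented two-prime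
certificate gives `β₂₃‖g‖₂² ≤ E₂₃(g) + Σ_r μ_r |Σ_k ĉ_{rk} M_k(g)|²` for the test functions of a class `P` supported in
`[-a₀, a₀]`, then on any window `c ≤ a₀` with `c < log 4`, `c ≤ (log (N+1))/2`, `3 ≤ N`, the TRUE functional satisfies
`(β₂₃ − ℓ(3,N)) ∫|φ|² ≤ Re Q(φ) + Σ_i μ_i |∫ φ · conj v_i|²`, `v_i = 𝟙_{[-c,c]} · maskPoly R_i`, for `φ ∈ P` supported in `[-c, c]`.
[cite: Yoshida1992, §2 eq. (2.1)] -/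
theorem hcert_of_cert23_sliverLoss {c a₀ : ℝ} (hca : c ≤ a₀) {N : ℕ} (hN : 3 ≤ N) (hc4 : c < Real.log 4)
    (hcN : c ≤ Real.log ((N : ℝ) + 1) / 2) (R : List (ℚ × ℕ × List ℚ)) (n : ℕ) {β₂₃ : ℝ}
    (P : (ℝ → ℂ) → Prop)
    (hcert23 : ∀ g : ℝ → ℂ, IsWeilTest g → tsupport g ⊆ Icc (-a₀) a₀ → P g →
      β₂₃ * weilNorm2Sq g ≤ weilTwoPrimeQuadratic g +
        (R.map fun r ↦ (r.1 : ℝ) * ‖∑ k ∈ Finset.range n, ((maskV r k : ℚ) : ℂ) * weilMoment a₀ g k‖ ^ 2).sum)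
    (v : Fin R.length → ℝ → ℂ)
    (hv : ∀ i x, v i x = (((Icc (-c) c).indicator (fun x ↦ maskPoly (R.get i) n a₀ x) x : ℝ) : ℂ)) :
    ∀ φ : ℝ → ℂ, IsWeilTest φ → tsupport φ ⊆ Icc (-c) c → P φ →
      (β₂₃ - weilSliverLoss 3 N) * ∫ x, ‖φ x‖ ^ 2 ≤
        (weilQuadratic φ).re + ∑ i, ((R.get i).1 : ℝ) * ‖∫ x, φ x * conj (v i x)‖ ^ 2 := by
  intro φ hφ hφs hφp
  have hφa : tsupport φ ⊆ Icc (-a₀) a₀ := hφs.trans (Icc_subset_Icc (by linarith) hca)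
  have h23 := hcert23 φ hφ hφa hφp
  have hsl := weilTwoPrimeQuadratic_sub_sliverLoss_le_weilQuadratic_re hφ hφs hN hc4 hcN
  have hsum : (R.map fun r ↦ (r.1 : ℝ) *
      ‖∑ k ∈ Finset.range n, ((maskV r k : ℚ) : ℂ) * weilMoment a₀ φ k‖ ^ 2).sum =
      ∑ i : Fin R.length, ((R.get i).1 : ℝ) * ‖∫ x, φ x * conj (v i x)‖ ^ 2 := by
    rw [dt_list_sum_map_eq_sum_get]
    refine Finset.sum_congr rfl fun i _ ↦ ?_
    rw [dt_rankOne_term_eq (R.get i) n a₀ hφ hφs]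
    simp only [hv i]
  have hn : weilNorm2Sq φ = ∫ x, ‖φ x‖ ^ 2 := rfl
  rw [hsum, hn] at h23
  rw [hn] at hsl
  rw [sub_mul]
  linarith

/-- **`λ ≤ ε_od(c)` on any window `c < log 4` from an ODD two-prime certificate, the sliver loss `ℓ(3,N)`
(`c ≤ (log (N+1))/2`) and the PSD datum** — GroundBarta's `dt_weilOddGroundEnergy_ge_of_deflCert` with `(log 5)/2, (log 2)/2`
replaced by `(log (N+1))/2, ℓ(3, N)`. [cite: WeinsteinStenger1972, Ch. 5 §9 eq. (2)] [cite: Lehmann1963, §2] -/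
theorem dt_weilOddGroundEnergy_ge_of_deflCert_sliverLoss {c : ℝ} (hc : 0 < c) {N : ℕ} (hN : 3 ≤ N)
    (hc4 : c < Real.log 4) (hcN : c ≤ Real.log ((N : ℝ) + 1) / 2)
    {a₀ : ℝ} (hca : c ≤ a₀) (R : List (ℚ × ℕ × List ℚ)) (n : ℕ) {β₂₃ : ℝ}
    (hRodd : ∀ i : Fin R.length, (R.get i).2.1 % 2 = 1) (hRμ : ∀ i : Fin R.length, 0 ≤ (R.get i).1)
    (hcert23 : ∀ g : ℝ → ℂ, IsWeilTest g → tsupport g ⊆ Icc (-a₀) a₀ → (∀ x, g (-x) = -g x) →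
      β₂₃ * weilNorm2Sq g ≤ weilTwoPrimeQuadratic g +
        (R.map fun r ↦ (r.1 : ℝ) * ‖∑ k ∈ Finset.range n, ((maskV r k : ℚ) : ℂ) * weilMoment a₀ g k‖ ^ 2).sum)
    (v F : Fin R.length → ℝ → ℂ)
    (hv : ∀ i x, v i x = (((Icc (-c) c).indicator (fun x ↦ maskPoly (R.get i) n a₀ x) x : ℝ) : ℂ))
    (hF : ∀ i y, F i y = (Icc (-c) c).indicator (fun y ↦
        2 * (∫ x, v i x * (Real.cosh (x / 2) : ℂ)) * (Real.cosh (y / 2) : ℂ) -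
          2 * (∫ x, v i x * (Real.sinh (x / 2) : ℂ)) * (Real.sinh (y / 2) : ℂ) +
        (∑ m ∈ weilPrimeIndex c, (((ArithmeticFunction.vonMangoldt m : ℝ) / Real.sqrt m : ℝ) : ℂ) *
          (2 * v i y - v i (y - Real.log m) - v i (y + Real.log m))) +
        ∫ t in Ioi 0, (weilArchDensity t : ℂ) * (2 * v i y - v i (y - t) - v i (y + t))) y -
      (weilMarkovConstant c : ℂ) * v i y)
    (W : Fin R.length → Fin R.length → ℝ) {lam : ℝ} (hlam : lam < β₂₃ - weilSliverLoss 3 N)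
    (hPSD : ∀ α : Fin R.length → ℝ, 0 ≤ ∑ i, ∑ j, α i * α j *
      ((β₂₃ - weilSliverLoss 3 N - lam) * ((weilPoleForm₂ (v i) (v j) + weilDirichletEnergy₂ c (v i) (v j) -
          weilMarkovConstant c * ∫ x, (v i x * conj (v j x)).re) - lam * ∫ x, (v i x * conj (v j x)).re) -
        ∫ x, ((F i - ∑ l, W i l • v l) x * conj ((F j - ∑ l, W j l • v l) x)).re)) :
    lam ≤ weilOddGroundEnergy c :=
  dt_weilOddGroundEnergy_ge_of_ritz hc (fun i x ↦ maskPoly (R.get i) n a₀ x)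
    (fun i ↦ contDiff_maskPoly (R.get i) n a₀) (fun i x ↦ maskPoly_neg_of_odd (R.get i) (hRodd i) n a₀ x)
    v F hv hF W (fun i ↦ ((R.get i).1 : ℝ)) hlam (fun i ↦ by exact_mod_cast hRμ i)
    (hcert_of_cert23_sliverLoss hca hN hc4 hcN R n (fun g ↦ ∀ x, g (-x) = -g x) hcert23 v hv) hPSD

/-- **`λ ≤ ε_ev(c)` on any window `c < log 4` from an EVEN two-prime certificate, the sliver loss and the PSD datum** —
the even-sector twin (penalty data of even parity, `maskPoly_neg_of_even`), which the positivity rungs need and the parity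
ladder does not. [cite: WeinsteinStenger1972, Ch. 5 §9 eq. (2)] [cite: Lehmann1963, §2] -/
theorem dt_weilEvenGroundEnergy_ge_of_deflCert_sliverLoss {c : ℝ} (hc : 0 < c) {N : ℕ} (hN : 3 ≤ N)
    (hc4 : c < Real.log 4) (hcN : c ≤ Real.log ((N : ℝ) + 1) / 2)
    {a₀ : ℝ} (hca : c ≤ a₀) (R : List (ℚ × ℕ × List ℚ)) (n : ℕ) {β₂₃ : ℝ}
    (hReven : ∀ i : Fin R.length, (R.get i).2.1 % 2 = 0) (hRμ : ∀ i : Fin R.length, 0 ≤ (R.get i).1)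
    (hcert23 : ∀ g : ℝ → ℂ, IsWeilTest g → tsupport g ⊆ Icc (-a₀) a₀ → (∀ x, g (-x) = g x) →
      β₂₃ * weilNorm2Sq g ≤ weilTwoPrimeQuadratic g +
        (R.map fun r ↦ (r.1 : ℝ) * ‖∑ k ∈ Finset.range n, ((maskV r k : ℚ) : ℂ) * weilMoment a₀ g k‖ ^ 2).sum)
    (v F : Fin R.length → ℝ → ℂ)
    (hv : ∀ i x, v i x = (((Icc (-c) c).indicator (fun x ↦ maskPoly (R.get i) n a₀ x) x : ℝ) : ℂ))
    (hF : ∀ i y, F i y = (Icc (-c) c).indicator (fun y ↦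
        2 * (∫ x, v i x * (Real.cosh (x / 2) : ℂ)) * (Real.cosh (y / 2) : ℂ) -
          2 * (∫ x, v i x * (Real.sinh (x / 2) : ℂ)) * (Real.sinh (y / 2) : ℂ) +
        (∑ m ∈ weilPrimeIndex c, (((ArithmeticFunction.vonMangoldt m : ℝ) / Real.sqrt m : ℝ) : ℂ) *
          (2 * v i y - v i (y - Real.log m) - v i (y + Real.log m))) +
        ∫ t in Ioi 0, (weilArchDensity t : ℂ) * (2 * v i y - v i (y - t) - v i (y + t))) y -
      (weilMarkovConstant c : ℂ) * v i y)
    (W : Fin R.length → Fin R.length → ℝ) {lam : ℝ} (hlam : lam < β₂₃ - weilSliverLoss 3 N)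
    (hPSD : ∀ α : Fin R.length → ℝ, 0 ≤ ∑ i, ∑ j, α i * α j *
      ((β₂₃ - weilSliverLoss 3 N - lam) * ((weilPoleForm₂ (v i) (v j) + weilDirichletEnergy₂ c (v i) (v j) -
          weilMarkovConstant c * ∫ x, (v i x * conj (v j x)).re) - lam * ∫ x, (v i x * conj (v j x)).re) -
        ∫ x, ((F i - ∑ l, W i l • v l) x * conj ((F j - ∑ l, W j l • v l) x)).re)) :
    lam ≤ weilEvenGroundEnergy c :=
  dt_weilEvenGroundEnergy_ge_of_ritz hc (fun i x ↦ maskPoly (R.get i) n a₀ x)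
    (fun i ↦ contDiff_maskPoly (R.get i) n a₀) (fun i x ↦ maskPoly_neg_of_even (R.get i) (hReven i) n a₀ x)
    v F hv hF W (fun i ↦ ((R.get i).1 : ℝ)) hlam (fun i ↦ by exact_mod_cast hRμ i)
    (hcert_of_cert23_sliverLoss hca hN hc4 hcN R n (fun g ↦ ∀ x, g (-x) = g x) hcert23 v hv) hPSD

/-- **Odd sector, sigma criterion**: as `dt_weilOddGroundEnergy_ge_of_deflCert_sliverLoss` with the PSD datum replaced by
residual norm bounds `∫‖F_i − Σ_l W_il v_l‖² ≤ s_i`, weights `θ_i > 0`, `Σ s_i/θ_i ≤ τ` and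
`(β₂₃ − ℓ(3,N) − λ)(A − λG) − τ·diag θ ⪰ 0`. [cite: GoerischHaunhorst1985, §2] [cite: WeinsteinStenger1972, Ch. 5 §9 eq. (2)] -/
theorem dt_weilOddGroundEnergy_ge_of_deflCert_sliverLoss_sigma {c : ℝ} (hc : 0 < c) {N : ℕ} (hN : 3 ≤ N)
    (hc4 : c < Real.log 4) (hcN : c ≤ Real.log ((N : ℝ) + 1) / 2)
    {a₀ : ℝ} (hca : c ≤ a₀) (R : List (ℚ × ℕ × List ℚ)) (n : ℕ) {β₂₃ : ℝ}
    (hRodd : ∀ i : Fin R.length, (R.get i).2.1 % 2 = 1) (hRμ : ∀ i : Fin R.length, 0 ≤ (R.get i).1)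
    (hcert23 : ∀ g : ℝ → ℂ, IsWeilTest g → tsupport g ⊆ Icc (-a₀) a₀ → (∀ x, g (-x) = -g x) →
      β₂₃ * weilNorm2Sq g ≤ weilTwoPrimeQuadratic g +
        (R.map fun r ↦ (r.1 : ℝ) * ‖∑ k ∈ Finset.range n, ((maskV r k : ℚ) : ℂ) * weilMoment a₀ g k‖ ^ 2).sum)
    (v F : Fin R.length → ℝ → ℂ)
    (hv : ∀ i x, v i x = (((Icc (-c) c).indicator (fun x ↦ maskPoly (R.get i) n a₀ x) x : ℝ) : ℂ))
    (hF : ∀ i y, F i y = (Icc (-c) c).indicator (fun y ↦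
        2 * (∫ x, v i x * (Real.cosh (x / 2) : ℂ)) * (Real.cosh (y / 2) : ℂ) -
          2 * (∫ x, v i x * (Real.sinh (x / 2) : ℂ)) * (Real.sinh (y / 2) : ℂ) +
        (∑ m ∈ weilPrimeIndex c, (((ArithmeticFunction.vonMangoldt m : ℝ) / Real.sqrt m : ℝ) : ℂ) *
          (2 * v i y - v i (y - Real.log m) - v i (y + Real.log m))) +
        ∫ t in Ioi 0, (weilArchDensity t : ℂ) * (2 * v i y - v i (y - t) - v i (y + t))) y -
      (weilMarkovConstant c : ℂ) * v i y)
    (W : Fin R.length → Fin R.length → ℝ) {lam : ℝ} (hlam : lam < β₂₃ - weilSliverLoss 3 N)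
    (s θ : Fin R.length → ℝ) (hθ : ∀ i, 0 < θ i) (hs : ∀ i, ∫ x, ‖(F i - ∑ l, W i l • v l) x‖ ^ 2 ≤ s i)
    {τ : ℝ} (hτ : ∑ i, s i / θ i ≤ τ)
    (hM : ∀ α : Fin R.length → ℝ, 0 ≤ ∑ i, ∑ j, α i * α j *
      ((β₂₃ - weilSliverLoss 3 N - lam) * ((weilPoleForm₂ (v i) (v j) + weilDirichletEnergy₂ c (v i) (v j) -
          weilMarkovConstant c * ∫ x, (v i x * conj (v j x)).re) - lam * ∫ x, (v i x * conj (v j x)).re) -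
        if i = j then τ * θ i else 0)) :
    lam ≤ weilOddGroundEnergy c :=
  dt_weilOddGroundEnergy_ge_of_deflCert_sliverLoss hc hN hc4 hcN hca R n hRodd hRμ hcert23 v F hv hF W hlam
    (dt_psd_of_sigma _ (fun i ↦ F i - ∑ l, W i l • v l)
      (dt_residual_memLp hc (fun i x ↦ maskPoly (R.get i) n a₀ x) (fun i ↦ contDiff_maskPoly (R.get i) n a₀)
        v F hv hF W)
      s θ hθ hs hτ hM)

/-- **Even sector, sigma criterion.** [cite: GoerischHaunhorst1985, §2] [cite: WeinsteinStenger1972, Ch. 5 §9 eq. (2)] -/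
theorem dt_weilEvenGroundEnergy_ge_of_deflCert_sliverLoss_sigma {c : ℝ} (hc : 0 < c) {N : ℕ} (hN : 3 ≤ N)
    (hc4 : c < Real.log 4) (hcN : c ≤ Real.log ((N : ℝ) + 1) / 2)
    {a₀ : ℝ} (hca : c ≤ a₀) (R : List (ℚ × ℕ × List ℚ)) (n : ℕ) {β₂₃ : ℝ}
    (hReven : ∀ i : Fin R.length, (R.get i).2.1 % 2 = 0) (hRμ : ∀ i : Fin R.length, 0 ≤ (R.get i).1)
    (hcert23 : ∀ g : ℝ → ℂ, IsWeilTest g → tsupport g ⊆ Icc (-a₀) a₀ → (∀ x, g (-x) = g x) →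
      β₂₃ * weilNorm2Sq g ≤ weilTwoPrimeQuadratic g +
        (R.map fun r ↦ (r.1 : ℝ) * ‖∑ k ∈ Finset.range n, ((maskV r k : ℚ) : ℂ) * weilMoment a₀ g k‖ ^ 2).sum)
    (v F : Fin R.length → ℝ → ℂ)
    (hv : ∀ i x, v i x = (((Icc (-c) c).indicator (fun x ↦ maskPoly (R.get i) n a₀ x) x : ℝ) : ℂ))
    (hF : ∀ i y, F i y = (Icc (-c) c).indicator (fun y ↦
        2 * (∫ x, v i x * (Real.cosh (x / 2) : ℂ)) * (Real.cosh (y / 2) : ℂ) -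
          2 * (∫ x, v i x * (Real.sinh (x / 2) : ℂ)) * (Real.sinh (y / 2) : ℂ) +
        (∑ m ∈ weilPrimeIndex c, (((ArithmeticFunction.vonMangoldt m : ℝ) / Real.sqrt m : ℝ) : ℂ) *
          (2 * v i y - v i (y - Real.log m) - v i (y + Real.log m))) +
        ∫ t in Ioi 0, (weilArchDensity t : ℂ) * (2 * v i y - v i (y - t) - v i (y + t))) y -
      (weilMarkovConstant c : ℂ) * v i y)
    (W : Fin R.length → Fin R.length → ℝ) {lam : ℝ} (hlam : lam < β₂₃ - weilSliverLoss 3 N)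
    (s θ : Fin R.length → ℝ) (hθ : ∀ i, 0 < θ i) (hs : ∀ i, ∫ x, ‖(F i - ∑ l, W i l • v l) x‖ ^ 2 ≤ s i)
    {τ : ℝ} (hτ : ∑ i, s i / θ i ≤ τ)
    (hM : ∀ α : Fin R.length → ℝ, 0 ≤ ∑ i, ∑ j, α i * α j *
      ((β₂₃ - weilSliverLoss 3 N - lam) * ((weilPoleForm₂ (v i) (v j) + weilDirichletEnergy₂ c (v i) (v j) -
          weilMarkovConstant c * ∫ x, (v i x * conj (v j x)).re) - lam * ∫ x, (v i x * conj (v j x)).re) -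
        if i = j then τ * θ i else 0)) :
    lam ≤ weilEvenGroundEnergy c :=
  dt_weilEvenGroundEnergy_ge_of_deflCert_sliverLoss hc hN hc4 hcN hca R n hReven hRμ hcert23 v F hv hF W hlam
    (dt_psd_of_sigma _ (fun i ↦ F i - ∑ l, W i l • v l)
      (dt_residual_memLp hc (fun i x ↦ maskPoly (R.get i) n a₀ x) (fun i ↦ contDiff_maskPoly (R.get i) n a₀)
        v F hv hF W)
      s θ hθ hs hτ hM)

/-! ## Composition with the rung registry -/

/-- **Two non-negative sector lower bounds at `c` give every rung `a ≤ c`.**  With `λ_ev`, `λ_od` the outputs of the two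
bridges above (`0 ≤ λ`): `WeilPositivityOn a`. [cite: Yoshida1992, §2] -/
theorem rung_of_sector_lower_bounds {c a le lo : ℝ} (hle : 0 ≤ le) (hlo : 0 ≤ lo)
    (hev : le ≤ weilEvenGroundEnergy c) (hod : lo ≤ weilOddGroundEnergy c) (hac : a ≤ c) :
    WeilPositivityOn a :=
  (dt_weilPositivityOn (hle.trans hev) (hlo.trans hod)).mono hac

/-- The window arithmetic of the last rung the bridge reaches: `log 3 = (log ((8 : ℕ) + 1))/2` and `log 3 < log 4`
(so `R4h = WeilPositivityOn (log 3)` takes `N = 8`, sliver loss `ℓ(3, 8)`, `weilSliverLoss_three_eight`). [folklore] -/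
theorem window_log_three :
    Real.log 3 = Real.log (((8 : ℕ) : ℝ) + 1) / 2 ∧ Real.log 3 < Real.log 4 := by
  refine ⟨?_, Real.log_lt_log (by norm_num) (by norm_num)⟩
  rw [show (((8 : ℕ) : ℝ) + 1) = 3 ^ 2 by norm_num, Real.log_pow]
  push_cast
  ring

/-- Likewise `(log 7)/2 = (log ((6 : ℕ) + 1))/2 < log 4` with `N = 6`, `ℓ(3, 6) = ℓ(3, 5) = (log 2)/2 + (log 5)/√5`
(`weilSliverLoss_three_six`, `weilSliverLoss_three_five`): the rungs on `((log 5)/2, (log 7)/2]`. [folklore] -/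
theorem window_log_seven_half :
    Real.log 7 / 2 = Real.log (((6 : ℕ) : ℝ) + 1) / 2 ∧ Real.log 7 / 2 < Real.log 4 := by
  refine ⟨by norm_num, ?_⟩
  have h7 : Real.log 7 < Real.log 16 := Real.log_lt_log (by norm_num) (by norm_num)
  have h16 : Real.log 16 = 2 * Real.log 4 := by
    rw [show (16 : ℝ) = 4 ^ 2 by norm_num, Real.log_pow]; push_cast; ring
  linarith

end Summit.RiemannHypothesis.RiemannHypothesis.Theorems.MotivicDoor.SliverBridge

end
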